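import Summits.BirchSwinnertonDyer.BirchSwinnertonDyer.Theorems.SemiOrdinaryEisensteinDescentWildKolyvaginUpperAtThreeOfMcCallum
import Summits.BirchSwinnertonDyer.BirchSwinnertonDyer.Theorems.ClassRecordThreeKolyvaginShaOrderDivisibleEnd
import HarnessLib

/-!
# Route `SemiOrdinaryEisensteinDescent`, crux Ko `WildKolyvaginUpperAtThree` (stmt-BirchSwinnertonDyer-20480), line `birth`
# v3: Ko BY NAME from its research input (J, point currency — or the class-currency stub `stub_minftyGeManin`) plus
# PRIMITIVE named print only — Kolyvagin 1990 Thm. A, the Cassels–Tate level inputs, Gross 1991 Prop. 3.7 (2)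
# (image-free), Gross–Zagier 1986 III (3.1) as Gross §6 uses it — with the Kolyvagin–McCallum structure theorem at the
# ADDITIVE prime `3` (`27 ∣ N`) no longer a named fact but a KERNEL THEOREM (lead prover bsd-wall-soed-p2 g2;
# `--supports stmt-BirchSwinnertonDyer-20480`; BSD is not proved by any of this)

WHY. The crux text records as a reason it might fail: «McCallum's structure theorem at p = 3 with 27 ∣ N is flagged
unverified in the tree». Until today every kernel road to Ko consumed Kolyvagin's structure theorem (upper half, McCallum
1991 Cor. 5.6 read as `ord_p #Ш(E/K)[p^∞] + 2t ≤ 2·ord_p[E(K) : ℤy_K]` under global divisibility to depth `t`) as a NAMED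
FACT: either the Matar–Nekovář §0.11 irreducible-image reading (`MatarNekovar2019.thm07_…`, flags
`MN19-0.11-structure-composite`, `Kolyvagin1991-ThmCD-primary-unread`; roads p544141, p567352, glue 20762, line `birth` v2's
`stub_inputs` = item 20761) or McCallum's tower-image form (`McCallum1991_padicValNat_card_sha_primary_add_le_of_globalDivisibility`,
flag `McCallum91-padic-image`; width seat w2's road `WildKolyvaginUpperAtThreeOfMcCallum`, 2026-08-27). On 2026-08-27 the cell
`bsd-stepL` (seat `bsd-stepL-tam3-p1` g9, crux 19109) DERIVED McCallum's tower-image fact IN THE KERNEL —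
`Literature.NumberTheory.EllipticCurves.McCallum1991_padicValNat_card_sha_primary_add_le_of_globalDivisibility_of_casselsTate_of_frobeniusCongruence_of_E0`
(`Theorems/ClassRecordThreeKolyvaginShaOrderDivisibleEnd.lean`) — from three standard named facts, over x11b3-p2's Kolyvagin
descent mod `p^M` (McCallum §§2–5; Čebotarev, the Weil pairing, Serre's open image and Poitou–Tate reciprocity PROVED there):
* `casselsTate_levelInputs K` (every number field `K`): the Cassels–Tate pairing inputs at finite level (Milne ADT I §6 + local
  class field theory);
* `GrossLMS1991.prop37_2_frobeniusCongruence`: Gross 1991 Prop. 3.7 (2), the Eichler–Shimura congruence for Heegner points of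
  higher conductor, in Nekovář's image-free rendering;
* `Gross1991_heegnerPoint_sub_ratTorsion_mem_E0`: Gross 1991 §6 / [GZ86 III (3.1)] — Heegner points lie in `E⁰` at the bad
  places up to rational torsion.
McCallum's §§4–5 carry NO hypothesis on the reduction of `E` at `p`; the kernel derivation therefore holds verbatim at the
additive prime `3` with `27 ∣ N` under the `3`-adic tower — which is EXACTLY the crux's binder `AdditiveThree.TowerSurjThree W`.
THIS FILE composes w2's McCallum road with that derivation: the structure-theorem input of Ko is discharged to primitive print,
and the line's print stub shrinks from {Kolyvagin Thm. A, Matar–Nekovář Thm. 0.7 composite} to {Kolyvagin Thm. A, Cassels–Tate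
level inputs, Gross Prop. 3.7 (2), GZ86 III (3.1)} — the same currency every other Kolyvagin road of the programme displays
(JET road K, ClassRecordThree, X11b). The research input (J = `WildSigmaDivisibilityAtThree`, stmt-20760: Σ-form global
divisibility of the derived Heegner points at the additive prime `3`, Manin-robust) is untouched and stays exactly as open as
before; so do Ko, the refined Kolyvagin conjecture at `3`, and BSD.

WHAT IS PROVED (CONDITIONAL on the displayed named facts and on the research input; nothing is asserted about any curve):
* `wildKolyvaginUpperAtThree_of_sigma_of_primitives` — **`J → (∀ kolyvagin) → (∀ K, casselsTate_levelInputs K) →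
  prop37_2_frobeniusCongruence → Gross1991_…_E0 → Ko`**, all route decls BY NAME: the primitive-print twin of the glue
  `WildKolyvaginUpperAtThreeOfSigma` (stmt-20762, closed via Matar–Nekovář) and of w2's `…_of_sigma_of_mcCallum`.
* `wildKolyvaginUpperAtThree_of_globalDivisibility_of_primitives` — the same with J displayed as a hypothesis in Ko's binders
  (point currency `Koly.PDiv`, depth `ord₃ ∏ c_ℓ + v₃ c(Dt)`).
* `wildKolyvaginUpperAtThree_of_minftyGeManin_of_primitives` — the same from line `birth`'s registered class-currency stub
  `stub_minftyGeManin` VERBATIM (through lead g0's unconditional CLASS ⟹ POINT bridge, p567352).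
* `wildKolyvaginUpperAtThree_of_sigma_of_primInputs` — the line-`birth` v3 COMPOSITION SHAPE: `J → PrimInputs → Ko` with
  `PrimInputs` spelled as the literal conjunction that is v3's registered print stub `stub_inputsPrim`.
References: [McCallumLMS1991] §1 Theorem (Kolyvagin), §4 Cor. 4.5, §5 Lemma 5.1 (p. 303), Thm. 5.4, Cor. 5.6 (p. 310);
[GrossLMS1991] §1 Thm. 1.3, §3 Prop. 3.7 (2) (p. 240), §6 Prop. 6.2 (1) (p. 245); [GrossZagier1986] III (3.1);
[MilneADT2006] I §6 Prop. 6.9, Thm. 6.13(a); [Jetchev2008] §1 (1), Conj. 1.3, Cor. 1.5 (p. 812); [KolyvaginEulerSystems1990] Thm. A.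
-/

set_option autoImplicit false
set_option linter.dupNamespace false -- `Summit.BirchSwinnertonDyer.BirchSwinnertonDyer.…` is the tree's layout (D-0017)

noncomputable section

open scoped Classical

namespace Summit.BirchSwinnertonDyer.BirchSwinnertonDyer.Theorems.WildKolyvaginUpperAtThreeOfPrimitives

open WeierstrassCurve NumberField Field IsDedekindDomain Literature.NumberTheory.EllipticCurves
  Literature.NumberTheory.EllipticCurves.ModularForms
  Summit.BirchSwinnertonDyer.Rank1Residual
  Summit.BirchSwinnertonDyer.Rank1Residual.Additive
  Summit.BirchSwinnertonDyer.Rank1Residual.X11b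
  Summit.BirchSwinnertonDyer.Rank1Residual.X11b.Three
  Summit.BirchSwinnertonDyer.BirchSwinnertonDyer.Theses.SemiOrdinaryEisensteinDescent
  Summit.BirchSwinnertonDyer.BirchSwinnertonDyer.Theorems.SchneiderFree

/-! ## §1 Ko BY NAME from J (point currency) + Kolyvagin Thm. A + {Cassels–Tate inputs, Gross 3.7 (2), GZ86 III (3.1)} -/

/-- **Crux Ko `WildKolyvaginUpperAtThree` ⟸ J = `WildSigmaDivisibilityAtThree` (stmt-20760, the research input, BY NAME) +
Kolyvagin 1990 Thm. A (named) + the three primitive named facts from which the cell `bsd-stepL` derived McCallum's Cor. 5.6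
upper half under the `p`-adic tower IN THE KERNEL** (`…_of_casselsTate_of_frobeniusCongruence_of_E0`, consumed through w2's
McCallum road `WildKolyvaginUpperAtThreeOfMcCallum.wildKolyvaginUpperAtThree_of_sigma_of_mcCallum`, which feeds the crux's own
binder `TowerSurjThree` to kmc g17's receptacle). The primitive-print twin of the glue `WildKolyvaginUpperAtThreeOfSigma`
(stmt-20762). CONDITIONAL on `hJ` (open), `hKo`, `hCT`, `h372`, `hE0`; Ko, J and BSD stay open.
[cite: McCallumLMS1991, §5 Cor. 5.6 (p. 310) and Lemma 5.1 (p. 303)] [cite: GrossLMS1991, §3 Prop. 3.7 (2) (p. 240) and §6 Prop. 6.2 (1) (p. 245)]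
[cite: GrossZagier1986, III (3.1)] [cite: Jetchev2008, Conj. 1.3 (p. 812)] -/
theorem wildKolyvaginUpperAtThree_of_sigma_of_primitives (hJ : WildSigmaDivisibilityAtThree)
    (hKo : ∀ (N : ℕ) [NeZero N] (W : WeierstrassCurve ℚ) (K : Type) [Field K] [NumberField K],
      kolyvagin N W K)
    (hCT : ∀ (K : Type) [Field K] [NumberField K], casselsTate_levelInputs K)
    (h372 : GrossLMS1991.prop37_2_frobeniusCongruence)
    (hE0 : Gross1991_heegnerPoint_sub_ratTorsion_mem_E0) :
    WildKolyvaginUpperAtThree :=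
  WildKolyvaginUpperAtThreeOfMcCallum.wildKolyvaginUpperAtThree_of_sigma_of_mcCallum hJ hKo
    (McCallum1991_padicValNat_card_sha_primary_add_le_of_globalDivisibility_of_casselsTate_of_frobeniusCongruence_of_E0
      hCT h372 hE0)

/-- **The same with J DISPLAYED as a hypothesis in exactly Ko's binders** (point currency `Koly.PDiv d 3 s′`, every
`s′ ≤ ord₃ ∏_ℓ c_ℓ(E) + v₃ c(Dt)`; = w2's `wildKolyvaginUpperAtThree_of_globalDivisibility_of_mcCallum` with `hMcU`
discharged to the three primitive facts). CONDITIONAL on `hJ`, `hKo`, `hCT`, `h372`, `hE0`.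
[cite: McCallumLMS1991, §5 Cor. 5.6 (p. 310)] [cite: Jetchev2008, Conj. 1.3 and (1) (p. 812)] -/
theorem wildKolyvaginUpperAtThree_of_globalDivisibility_of_primitives
    (hKo : ∀ (N : ℕ) [NeZero N] (W : WeierstrassCurve ℚ) (K : Type) [Field K] [NumberField K],
      kolyvagin N W K)
    (hCT : ∀ (K : Type) [Field K] [NumberField K], casselsTate_levelInputs K)
    (h372 : GrossLMS1991.prop37_2_frobeniusCongruence)
    (hE0 : Gross1991_heegnerPoint_sub_ratTorsion_mem_E0)
    (hJ : ∀ (W : WeierstrassCurve ℚ) [W.IsElliptic] [W.IsGloballyMinimal] (N : ℕ) [NeZero N] (K : Type)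
      [Field K] [NumberField K] (Dt : ModularParametrizationData W N)
      (H : HeegnerDatum N (NumberField.discr K)) (ι : K →+* ℂ) (P : (W.baseChange K).toAffine.Point),
      ClassO6 W 3 → W.HasSurjectiveModNGaloisRep 3 → W.analyticRank = 1 → W.conductorNorm ℤ = N →
      IsImaginaryQuadratic K → SatisfiesHeegnerHypothesis N K →
      (W.quadraticTwist (NumberField.discr K : ℚ)).entireLFunction 1 ≠ 0 →
      WeierstrassCurve.Affine.Point.map ι.toRatAlgHom P = heegnerPointComplex Dt H →
      ¬ IsOfFinAddOrder P → Odd (NumberField.discr K) → NumberField.discr K ≠ -3 →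
      AdditiveThree.TowerSurjThree W →
      ∀ (s' : ℕ), s' ≤ padicValNat 3 W.tamagawaProduct + padicValNat 3 Dt.c.natAbs →
        ∀ (n : ℕ) (d : KolyvaginHeegnerData Dt H.β ι n), Squarefree n →
          (∀ ℓ ∈ n.primeFactors, Zhang2014.IsKolyvaginPrime N W K 3 ℓ ∧
            s' ≤ Zhang2014.kolyvaginIndex W 3 ℓ) → Koly.PDiv d 3 s') :
    WildKolyvaginUpperAtThree :=
  WildKolyvaginUpperAtThreeOfMcCallum.wildKolyvaginUpperAtThree_of_globalDivisibility_of_mcCallum hKo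
    (McCallum1991_padicValNat_card_sha_primary_add_le_of_globalDivisibility_of_casselsTate_of_frobeniusCongruence_of_E0
      hCT h372 hE0) hJ

/-! ## §2 Ko BY NAME from line `birth`'s class-currency stub + Kolyvagin Thm. A + the three primitive facts -/

/-- **Crux Ko ⟸ `stub_minftyGeManin` (line `birth`, registered v1 = v2, class currency `AdditiveThree.MinftyGe`, VERBATIM as a
hypothesis) + Kolyvagin 1990 Thm. A + {Cassels–Tate inputs, Gross 3.7 (2), GZ86 III (3.1)}** — w2's
`wildKolyvaginUpperAtThree_of_minftyGeManin_of_mcCallum` (through lead g0's unconditional CLASS ⟹ POINT bridge, p567352) with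
`hMcU` discharged. The class stub is formally STRONGER than J (CLASS ⟹ POINT is proved, POINT ⟹ CLASS at a fixed level is not
formal), so line `birth` v3 registers J itself; this theorem records that the v2 stub still suffices. CONDITIONAL on `hM`
(open), `hKo`, `hCT`, `h372`, `hE0`. [cite: McCallumLMS1991, §5 Cor. 5.6 (p. 310) and §4 Cor. 4.5] [cite: WZhang2014, §3.8] -/
theorem wildKolyvaginUpperAtThree_of_minftyGeManin_of_primitives
    (hKo : ∀ (N : ℕ) [NeZero N] (W : WeierstrassCurve ℚ) (K : Type) [Field K] [NumberField K],
      kolyvagin N W K)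
    (hCT : ∀ (K : Type) [Field K] [NumberField K], casselsTate_levelInputs K)
    (h372 : GrossLMS1991.prop37_2_frobeniusCongruence)
    (hE0 : Gross1991_heegnerPoint_sub_ratTorsion_mem_E0)
    (hM : ∀ (W : WeierstrassCurve ℚ) [W.IsElliptic] [W.IsGloballyMinimal],
      Summit.BirchSwinnertonDyer.Rank1Residual.Additive.ClassO6 W 3 → W.HasSurjectiveModNGaloisRep 3 →
      W.analyticRank = 1 → Summit.BirchSwinnertonDyer.Rank1Residual.AdditiveThree.TowerSurjThree W →
      ∀ (K : Type) [Field K] [NumberField K], Literature.NumberTheory.EllipticCurves.IsImaginaryQuadratic K →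
      Odd (NumberField.discr K) → NumberField.discr K ≠ -3 → ∀ [NeZero (W.conductorNorm ℤ)],
      Literature.NumberTheory.EllipticCurves.SatisfiesHeegnerHypothesis (W.conductorNorm ℤ) K →
      (W.quadraticTwist (NumberField.discr K : ℚ)).entireLFunction 1 ≠ 0 →
      ∀ (Dt : Literature.NumberTheory.EllipticCurves.ModularForms.ModularParametrizationData W (W.conductorNorm ℤ))
        (H : Literature.NumberTheory.EllipticCurves.HeegnerDatum (W.conductorNorm ℤ) (NumberField.discr K))
        (ι : K →+* ℂ) (P : (W.baseChange K).toAffine.Point),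
      (WeierstrassCurve.Affine.Point.map ι.toRatAlgHom) P =
        Literature.NumberTheory.EllipticCurves.ModularForms.heegnerPointComplex Dt H →
      ¬ IsOfFinAddOrder P →
      Summit.BirchSwinnertonDyer.Rank1Residual.AdditiveThree.MinftyGe W K Dt H.β ι
        (padicValNat 3 W.tamagawaProduct + padicValNat 3 Dt.c.natAbs)) :
    WildKolyvaginUpperAtThree :=
  WildKolyvaginUpperAtThreeOfMcCallum.wildKolyvaginUpperAtThree_of_minftyGeManin_of_mcCallum hKo
    (McCallum1991_padicValNat_card_sha_primary_add_le_of_globalDivisibility_of_casselsTate_of_frobeniusCongruence_of_E0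
      hCT h372 hE0) hM

/-! ## §3 The composition shape of line `birth` v3: `J → PrimInputs → Ko` -/

/-- **Line `birth` v3, composition shape: `J → PrimInputs → Ko`** where `PrimInputs` is the LITERAL conjunction registered
as v3's print stub `stub_inputsPrim` — (i) Kolyvagin 1990 Thm. A `∀ N W K, kolyvagin N W K`; (ii) the Cassels–Tate level
inputs at every number field; (iii) Gross 1991 Prop. 3.7 (2), image-free; (iv) Gross 1991 §6 / GZ86 III (3.1) — so that the
skeleton's `WildKolyvaginUpperAtThree_of` is this term applied to its two stubs. The primitive-print analogue of the route
glue `WildKolyvaginUpperAtThreeOfSigma` (`J → KolyvaginStructureInputsAtThree → Ko`, stmt-20762). CONDITIONAL on both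
hypotheses; nothing about any curve is asserted. [cite: McCallumLMS1991, §5 Cor. 5.6 (p. 310)]
[cite: GrossLMS1991, §1 Thm. 1.3 and §3 Prop. 3.7 (2)] [cite: MilneADT2006, I §6 Thm. 6.13(a)] [cite: GrossZagier1986, III (3.1)] -/
theorem wildKolyvaginUpperAtThree_of_sigma_of_primInputs (hJ : WildSigmaDivisibilityAtThree)
    (hPrim : (∀ (N : ℕ) [NeZero N] (W : WeierstrassCurve ℚ) (K : Type) [Field K] [NumberField K],
        Literature.NumberTheory.EllipticCurves.kolyvagin N W K) ∧
      (∀ (K : Type) [Field K] [NumberField K], Literature.NumberTheory.EllipticCurves.casselsTate_levelInputs K) ∧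
      Literature.NumberTheory.EllipticCurves.GrossLMS1991.prop37_2_frobeniusCongruence ∧
      Literature.NumberTheory.EllipticCurves.Gross1991_heegnerPoint_sub_ratTorsion_mem_E0) :
    WildKolyvaginUpperAtThree :=
  wildKolyvaginUpperAtThree_of_sigma_of_primitives hJ hPrim.1 hPrim.2.1 hPrim.2.2.1 hPrim.2.2.2

end Summit.BirchSwinnertonDyer.BirchSwinnertonDyer.Theorems.WildKolyvaginUpperAtThreeOfPrimitives

end
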